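import Mathlib
import Literature.Analysis.FluidPDE.Tao2016AveragedNS.ShiftSetCascadeFlows
import Summits.NavierStokesRegularity.NavierStokesRegularity.Theorems.TaoLadderRungTwoFlatCertificateGlueLohnerRowRemOn
import HarnessLib

/-!
# Certificate glue on a shift set `𝕊`, XXXVIII-k: THE VARIATIONAL TAYLOR TAIL BY THE METHOD OF MAJORANTS — `varJet_row_bound` (per-row Cauchy majorant of the
  variational jets), `tailVR` / `tailVQ` (the tail sum `Σ_{pᵥ<k≤p} (k+1)·m·(bm)^{k−1}·u^k`, real / exact rational) and `abs_VPoly_sub_VPoly_le` (the variational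
  Taylor polynomial of order `p` differs from the one of order `pᵥ ≤ p` by at most `b_c · ρ · tailVR · w_c`) (helper for items stmt-NavierStokesRegularity-22987
  `FlatGapCertificatesV2` (crux K_A♭ of route TaoLadderRungTwoFlat) and stmt-24295 K_A₂(64); cell harvest/h2-tao-ladder, p1 g18)

WHY. In the mean-value Lohner step (glue XVIII-c / XIX-i) the frame enclosure `κ` and the remainder-direction bound `NVE` are bounds on `VPoly` of the SAME
order `p` as the state polynomial `TPoly` (it is its exact derivative). Evaluating the variational recursion to order `p` costs `O(p²)` sparse matrix products
(glue XXXVIII-c); with this file a checker may evaluate it to a LOWER order `pᵥ` and pay the dropped orders `pᵥ < k ≤ p` with the closed majorant tail — on the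
cell's records `b·m′·h ≤ 10⁻²`, so `pᵥ = 4…6` leaves a tail below `10⁻¹⁵` relative while dividing the variational work by `≈ 6…13`.

HONEST FRAMING: abstract finite-dimensional ODE analysis (method of majorants, Berz–Makino / Zgliczyński; the tree's `TaylorModelMajorant` toolkit); nothing about
any particular table, no stub closed, nothing here is a statement about the Navier–Stokes equations.
-/

noncomputable section

-- the sub-problem namespace repeats the summit name by design (D-0017)
set_option linter.dupNamespace false

namespace Summit.NavierStokesRegularity.NavierStokesRegularity.Theorems

open Set Finset Summit.NavierStokesRegularity.NavierStokesRegularity.Theorems.TaylorModelReadout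
open Summit.NavierStokesRegularity.NavierStokesRegularity.Theorems.TaylorModelMajorant

namespace CertificateGlueOn

variable {n : ℕ} {Q : (Fin n → ℝ) → (Fin n → ℝ) → Fin n → ℝ} {w : Fin n → ℝ} {b : ℝ}

/-! ### Per-row majorant of the variational jets -/

/-- **Per-row Cauchy majorant of the variational jets**: with row constants `b_c` on top of the uniform bound `b`,
`|U_{k+1}(x)(v)_c| ≤ b_c · m · ρ · (k+2) · (bm)^k · w_c` for `|x| ≤ m·w`, `|v| ≤ ρ·w` (the coefficients of `b_c m ρ · d/dy [y/(1 − b y s)]`).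
[cite: BerzMakino1998, §2–3 (verified integration of ODE flows by Taylor models: remainder by the majorant series)] -/
theorem varJet_row_bound (h : IsMajorantSystem n Q w b (taylorJet Q) (varJet Q)) {brow : Fin n → ℝ}
    (hBrow : ∀ (u v : Fin n → ℝ) (Nu Nv : ℝ), 0 ≤ Nu → 0 ≤ Nv → (∀ c, |u c| ≤ Nu * w c) → (∀ c, |v c| ≤ Nv * w c) →
      ∀ c, |Q u v c| ≤ brow c * Nu * Nv * w c)
    {x v : Fin n → ℝ} {m ρ : ℝ} (hx : ∀ c, |x c| ≤ m * w c) (hv : ∀ c, |v c| ≤ ρ * w c) (k : ℕ) (c : Fin n) :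
    |varJet Q x v (k + 1) c| ≤ brow c * m * ρ * ((k : ℝ) + 2) * (b * m) ^ k * w c := by
  have hm : 0 ≤ m := h.nonneg_of_wbound c (hx c)
  have hρ : 0 ≤ ρ := h.nonneg_of_wbound c (hv c)
  have hbm : 0 ≤ b * m := mul_nonneg h.b_nonneg hm
  have hT := h.T_bound hx
  have hU := h.U_bound hx hv
  refine abs_le_of_mul_eq_sum (h.U_succ x v k c)
    (g := fun i => 2 * ((((k - i : ℕ) : ℝ) + 1) * (brow c * m * ρ * (b * m) ^ k * w c))) ?_ ?_
  · intro i hi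
    obtain ⟨j, rfl⟩ := Nat.exists_eq_add_of_le (Nat.lt_succ_iff.mp (mem_range.mp hi))
    rw [Nat.add_sub_cancel_left]
    calc |Q (taylorJet Q x i) (varJet Q x v j) c + Q (varJet Q x v j) (taylorJet Q x i) c|
        ≤ |Q (taylorJet Q x i) (varJet Q x v j) c| + |Q (varJet Q x v j) (taylorJet Q x i) c| := abs_add_le _ _
      _ ≤ brow c * (m * (b * m) ^ i) * (((j : ℝ) + 1) * ρ * (b * m) ^ j) * w c +
            brow c * (((j : ℝ) + 1) * ρ * (b * m) ^ j) * (m * (b * m) ^ i) * w c :=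
          add_le_add (hBrow _ _ _ _ (by positivity) (by positivity) (hT i) (hU j) c)
            (hBrow _ _ _ _ (by positivity) (by positivity) (hU j) (hT i) c)
      _ = 2 * ((((j : ℕ) : ℝ) + 1) * (brow c * m * ρ * (b * m) ^ (i + j) * w c)) := by rw [pow_add]; ring
  · have hs := sum_range_cast_sub_add_one k
    refine le_of_eq ?_
    calc ∑ i ∈ range (k + 1), 2 * ((((k - i : ℕ) : ℝ) + 1) * (brow c * m * ρ * (b * m) ^ k * w c))
        = 2 * (brow c * m * ρ * (b * m) ^ k * w c) * ∑ i ∈ range (k + 1), (((k - i : ℕ) : ℝ) + 1) := by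
          rw [mul_sum]
          exact sum_congr rfl fun i _ => by ring
      _ = _ := by rw [hs]; ring

/-! ### The tail sum -/

/-- The variational tail majorant `Σ_{pᵥ < k ≤ p} (k+1)·m·(bm)^{k−1}·u^k` (real). [folklore] -/
def tailVR (pv p : ℕ) (b m u : ℝ) : ℝ := ∑ k ∈ Finset.Ico (pv + 1) (p + 1), ((k : ℝ) + 1) * m * (b * m) ^ (k - 1) * u ^ k

/-- The same sum in exact rational arithmetic (what a checker evaluates). [folklore] -/
def tailVQ (pv p : ℕ) (b m u : ℚ) : ℚ := ∑ k ∈ Finset.Ico (pv + 1) (p + 1), ((k : ℚ) + 1) * m * (b * m) ^ (k - 1) * u ^ k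

/-- Cast of the rational tail. [folklore] -/
theorem cast_tailVQ (pv p : ℕ) (b m u : ℚ) : ((tailVQ pv p b m u : ℚ) : ℝ) = tailVR pv p (b : ℝ) (m : ℝ) (u : ℝ) := by
  simp only [tailVQ, tailVR]
  push_cast
  rfl

/-- The tail is nonnegative for nonnegative data. [folklore] -/
theorem tailVR_nonneg (pv p : ℕ) {b m u : ℝ} (hb : 0 ≤ b) (hm : 0 ≤ m) (hu : 0 ≤ u) : 0 ≤ tailVR pv p b m u :=
  sum_nonneg fun k _ => by positivity

/-! ### The truncation bound -/

/-- **THE VARIATIONAL TAYLOR TAIL**: for `pᵥ ≤ p`, `|x| ≤ m·w`, `|v| ≤ ρ·w` and `0 ≤ u`,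
`|VPoly_p(x)(v)(u)_c − VPoly_{pᵥ}(x)(v)(u)_c| ≤ b_c · ρ · tailVR pᵥ p b m u · w_c`.
[cite: BerzMakino1998, §2–3 (remainder of a Taylor model by the majorant series)] -/
theorem abs_VPoly_sub_VPoly_le (h : IsMajorantSystem n Q w b (taylorJet Q) (varJet Q)) {brow : Fin n → ℝ}
    (hBrow : ∀ (u v : Fin n → ℝ) (Nu Nv : ℝ), 0 ≤ Nu → 0 ≤ Nv → (∀ c, |u c| ≤ Nu * w c) → (∀ c, |v c| ≤ Nv * w c) →
      ∀ c, |Q u v c| ≤ brow c * Nu * Nv * w c)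
    {x v : Fin n → ℝ} {m ρ : ℝ} (hx : ∀ c, |x c| ≤ m * w c) (hv : ∀ c, |v c| ≤ ρ * w c) {pv p : ℕ} (hpv : pv ≤ p) {u : ℝ} (hu : 0 ≤ u)
    (c : Fin n) :
    |VPoly Q p x v u c - VPoly Q pv x v u c| ≤ brow c * ρ * tailVR pv p b m u * w c := by
  -- the difference is the sum over the dropped orders
  have hsplit : VPoly Q p x v u c - VPoly Q pv x v u c = ∑ k ∈ Finset.Ico (pv + 1) (p + 1), varJet Q x v k c * u ^ k := by
    simp only [VPoly]
    rw [Finset.range_eq_Ico, Finset.range_eq_Ico, ← Finset.sum_Ico_consecutive _ (Nat.zero_le (pv + 1)) (by omega : pv + 1 ≤ p + 1)]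
    ring
  rw [hsplit, tailVR, Finset.mul_sum, Finset.sum_mul]
  refine (abs_sum_le_sum_abs _ _).trans (sum_le_sum fun k hk => ?_)
  have hk1 : 1 ≤ k := by have := (Finset.mem_Ico.mp hk).1; omega
  obtain ⟨k', rfl⟩ := Nat.exists_eq_add_of_le hk1
  rw [abs_mul, abs_of_nonneg (pow_nonneg hu _), show 1 + k' - 1 = k' by omega, show 1 + k' = k' + 1 by ring]
  have hU := varJet_row_bound h hBrow hx hv k' c
  have hw : 0 ≤ w c := (h.w_pos c).le
  calc |varJet Q x v (k' + 1) c| * u ^ (k' + 1)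
      ≤ (brow c * m * ρ * ((k' : ℝ) + 2) * (b * m) ^ k' * w c) * u ^ (k' + 1) := mul_le_mul_of_nonneg_right hU (pow_nonneg hu _)
    _ = brow c * ρ * ((((k' + 1 : ℕ) : ℝ) + 1) * m * (b * m) ^ k' * u ^ (k' + 1)) * w c := by push_cast; ring

end CertificateGlueOn

end Summit.NavierStokesRegularity.NavierStokesRegularity.Theorems

end
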